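import Literature.Probability.RandomPlanarGeometry.SAWAllTurnPolygonsFromBridges
import Literature.Probability.RandomPlanarGeometry.SAWAllTurnHammersleyWelsh
import Literature.Probability.RandomPlanarGeometry.SAWAllTurnBridgeLeMu
import Mathlib.Analysis.SpecialFunctions.Pow.Asymptotics
import Mathlib.Analysis.SpecialFunctions.Pow.Real
import HarnessLib

/-!
# The all-turn (`L`-lattice) polygon theorem: `lim (4n)⁻¹ log q(4n) = log μ_AT`, with the rate `O(n^{-1/2})` («L-POLY», «L-POLY-RATE»)

Topic `Literature/Probability/RandomPlanarGeometry` — final assembly of the lane's «L-POLY» programme (a-idea-2 gen 9,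
`Sketch_v9_LPOLY.lean` 481736c9 / `Sketch_v9R_LPOLYRate.lean` 9cc7a3a3; statements verbatim over the tree objects):
* inputs (all in the tree): K1 `allTurnHW` + S1 `allTurnSwap` + S4 `allTurnHWSplit` + `muAT` (`SAWAllTurnHammersleyWelsh`,
  a-p3 g4), K2 `allTurnPolygonsFromBridges` + `allTurnLoops`/`allTurnPolygonCount` (`SAWAllTurnPolygonsFromBridges`,
  a-p1 g5), S5/S6 + the all-turn objects (`SAWAllTurnUnfoldConcat`, a-p6 g3), S7 `allTurnBridgeLeMu` + the S8 glue
  `allTurnHWUpper_of` (`SAWAllTurnBridgeLeMu`, a-p6 g3), S2 Fekete `tendsto_log_allTurnCount_div`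
  (`SAWBendingEnergyAllTurnWindow`);
* this file: S3 `polygonLeWalk` and the K3 reduction `allTurnHammersley_of` (a-p5 g3's text, verbatim), the K3R glue
  `allTurnHammersleyRate_of` / `tendsto_of_rate` (a-idea-2 g9's `Final_RATE_of.lean` 046d0083, verbatim), and the
  headlines **`allTurnHammersley`** — `Tendsto (fun n => log q(4n) / (4n)) atTop (𝓝 (log μ_AT))` —, **`allTurnHWUpper`**
  (S8: `a(N) ≤ e^{c√N} μ_AT^N`) and **`allTurnHammersleyRate`** (K3R: `|log q(4n)/(4n) − log μ_AT| ≤ C/√n`, `n ≥ 4`).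

Here `q(L) = allTurnPolygonCount L` counts rooted oriented all-turn `L`-step self-avoiding polygons on `ℤ²` (= `2L·p(L)`;
the lane's counts reproduce Enting–Guttmann 1985's printed `L`-lattice polygon series, EIS M1930, to `L = 28`), and
`μ_AT = exp (logMuAT)` is the growth constant of all-turn (= `L`-lattice) self-avoiding walks (`SAWBendingEnergyEndpoint`;
certified window `[3/2, 1.59512]`, `SAWAllTurnGrowthZ2`). L-LATTICE POLYGON THEOREM: the exponential growth rate of all-turn
polygons equals that of all-turn walks — the `ℤ²`-directed analogue of Hammersley 1961 / Madras–Slade Theorem 3.2.3–3.2.4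
(HW unfolding + "two bridges make a polygon" with parity-adaptive connectors, run inside the all-turn class). Printed
status (lit-2 g10 + lit-1 g6, two independent searches): not found in print as a theorem; for polygons counted by right
angles Janse van Rensburg 2015 §5.3.1 (paragraph before Theorem 5.46) records only `√2 ≤ 𝒫_s(1) ≤ μ` and "continuity at
ε = 1 … is not established" — this file proves the endpoint VALUE `μ_SAP = μ_SAW` for the all-turn class; continuity
of JvR 2015 §5.3.1's `𝒫_s` at `ε = 1` is a concavity statement about a family not formalised here.
[cite: MadrasSlade1993, Theorem 3.2.3, Theorem 3.2.4, Corollary 3.2.5; EntingGuttmann1985; Malakis1975;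
JansevanRensburg2015, §5.3.1 (paragraph before Theorem 5.46)]
-/

noncomputable section

open Finset Filter Topology
open scoped BigOperators
open Literature.Probability.LatticeModels Literature.Probability.Percolation

namespace Literature.Probability.RandomPlanarGeometry.SAW.Zd

open Literature.Probability.RandomPlanarGeometry.SAW

/-- **S3 `PolygonLeWalk`**: forgetting the closing step, `q(L) ≤ a(L-1)` (a rooted all-turn polygon's first
`L-1` steps form an all-turn self-avoiding walk). [cite: MadrasSlade1993, §3.2] -/
theorem polygonLeWalk (L : ℕ) : allTurnPolygonCount L ≤ allTurnCount (L - 1) := by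
  classical
  rw [allTurnPolygonCount, allTurnCount, allTurnLoops]
  refine Finset.card_le_card fun ω hω => ?_
  rw [Finset.mem_filter] at hω ⊢
  refine ⟨hω.1, ?_⟩
  have := hω.2.1
  omega

/-- `log` is monotone on naturals (Lean's `log 0 = 0`). [cite: MadrasSlade1993, §1.2] -/
private theorem log_nat_mono {p a : ℕ} (h : p ≤ a) : Real.log p ≤ Real.log a := by
  rcases Nat.eq_zero_or_pos p with rfl | hp
  · simp only [Nat.cast_zero, Real.log_zero]; exact Real.log_natCast_nonneg a
  · exact Real.log_le_log (by exact_mod_cast hp) (by exact_mod_cast h)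

/-- `log n / n → 0` along the naturals. [cite: MadrasSlade1993, §1.2] -/
private theorem tendsto_log_div_nat : Tendsto (fun n : ℕ => Real.log n / n) atTop (𝓝 0) := by
  have h := (Real.tendsto_pow_log_div_mul_add_atTop 1 0 1 one_ne_zero).comp tendsto_natCast_atTop_atTop
  refine h.congr' (Eventually.of_forall fun n => ?_)
  simp [Function.comp]

/-- `1/√n → 0` along the naturals. [cite: MadrasSlade1993, §1.2] -/
private theorem tendsto_inv_sqrt_nat : Tendsto (fun n : ℕ => (Real.sqrt n)⁻¹) atTop (𝓝 0) :=
  (Real.tendsto_sqrt_atTop.comp tendsto_natCast_atTop_atTop).inv_tendsto_atTop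

/-- **K3 — the all-turn (`L`-lattice) Hammersley theorem, assembled from the two cruxes** (a-idea-2's
squeeze, verbatim up to names): given the all-turn Hammersley–Welsh bridge lower bound along even lengths
(K1, for some bridge-type count `b`) and the all-turn planar gluing inequality
`b(M)² ≤ 16(2M+5)⁴(M+3)² q(2M+12)` (K2), `(1/4n) log q(4n) → log μ_AT` (S2 = tree
`Zd.tendsto_log_allTurnCount_div`, S3 = `polygonLeWalk`). [cite: MadrasSlade1993, Corollary 3.2.5; JansevanRensburg2015, §5.3.1 (paragraph before Theorem 5.46)] -/
theorem allTurnHammersley_of (b : ℕ → ℕ)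
    (hHW : ∃ c : ℝ, ∀ m : ℕ, Real.exp (-(c * Real.sqrt m)) * muAT ^ (2 * m) ≤ (b (2 * m) : ℝ))
    (hK2 : ∀ M : ℕ, 2 ≤ M → Even M →
      b M ^ 2 ≤ 16 * (2 * M + 5) ^ 4 * (M + 3) ^ 2 * allTurnPolygonCount (2 * M + 12)) :
    Tendsto (fun n : ℕ => Real.log (allTurnPolygonCount (4 * n)) / (4 * (n : ℝ))) atTop (𝓝 logMuAT) := by
  have hF : Tendsto (fun n : ℕ => Real.log (allTurnCount n) / n) atTop (𝓝 logMuAT) :=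
    tendsto_log_allTurnCount_div
  have hS3 : ∀ L : ℕ, allTurnPolygonCount L ≤ allTurnCount (L - 1) := polygonLeWalk
  obtain ⟨c, hc⟩ := hHW
  -- WLOG the HW constant is nonnegative
  set c' : ℝ := max c 0 with hc'def
  have hc'0 : 0 ≤ c' := le_max_right _ _
  have hμpos : 0 < muAT := Real.exp_pos _
  have hb : ∀ m : ℕ, Real.exp (-(c' * Real.sqrt m)) * muAT ^ (2 * m) ≤ (b (2 * m) : ℝ) := by
    intro m
    refine le_trans ?_ (hc m)
    have h1 : Real.exp (-(c' * Real.sqrt m)) ≤ Real.exp (-(c * Real.sqrt m)) := by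
      apply Real.exp_le_exp.2
      have := Real.sqrt_nonneg (m : ℝ)
      nlinarith [le_max_left c 0]
    exact mul_le_mul_of_nonneg_right h1 (pow_nonneg hμpos.le _)
  -- the three sequences
  set u : ℕ → ℝ := fun n => Real.log (allTurnPolygonCount (4 * n)) / (4 * (n : ℝ)) with hu
  set v : ℕ → ℝ := fun n => Real.log (allTurnCount (4 * n - 1)) / (4 * (n : ℝ)) with hv
  set P : ℕ → ℕ := fun n => 16 * (2 * (2 * n - 6) + 5) ^ 4 * ((2 * n - 6) + 3) ^ 2 with hP
  set w : ℕ → ℝ := fun n =>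
    (4 * ((n : ℝ) - 3) * logMuAT - 2 * c' * Real.sqrt n - Real.log (P n)) / (4 * (n : ℝ)) with hw
  show Tendsto u atTop (𝓝 logMuAT)
  ------------------------------------------------------------------
  -- (1) v → log μ_AT  (S2 along 4n-1, times (4n-1)/(4n) → 1)
  ------------------------------------------------------------------
  have h4 : Tendsto (fun n : ℕ => 4 * n - 1) atTop atTop := by
    refine tendsto_atTop_atTop.2 fun b => ⟨b + 1, fun n hn => ?_⟩
    omega
  have hF' : Tendsto (fun n : ℕ => Real.log (allTurnCount (4 * n - 1)) / ((4 * n - 1 : ℕ) : ℝ)) atTop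
      (𝓝 logMuAT) := hF.comp h4
  have hr : Tendsto (fun n : ℕ => (((4 * n - 1 : ℕ) : ℝ)) / (4 * (n : ℝ))) atTop (𝓝 1) := by
    have h0 : Tendsto (fun n : ℕ => (1 : ℝ) - (1 / 4) * (1 / (n : ℝ))) atTop (𝓝 (1 - (1 / 4) * 0)) :=
      tendsto_const_nhds.sub (tendsto_const_nhds.mul tendsto_one_div_atTop_nhds_zero_nat)
    rw [mul_zero, sub_zero] at h0
    refine h0.congr' ?_
    filter_upwards [eventually_ge_atTop 1] with n hn
    have hn' : (0 : ℝ) < n := by exact_mod_cast hn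
    have : ((4 * n - 1 : ℕ) : ℝ) = 4 * (n : ℝ) - 1 := by
      rw [Nat.cast_sub (by omega)]; push_cast; ring
    rw [this]; field_simp
  have hv_lim : Tendsto v atTop (𝓝 logMuAT) := by
    have := hF'.mul hr
    rw [mul_one] at this
    refine this.congr' ?_
    filter_upwards [eventually_ge_atTop 1] with n hn
    have hpos : (0 : ℝ) < ((4 * n - 1 : ℕ) : ℝ) := by exact_mod_cast (show 0 < 4 * n - 1 by omega)
    have hn' : (0 : ℝ) < n := by exact_mod_cast hn
    simp only [hv]
    field_simp
  ------------------------------------------------------------------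
  -- (2) u ≤ v for n ≥ 1  (S3)
  ------------------------------------------------------------------
  have huv : ∀ᶠ n in atTop, u n ≤ v n := by
    filter_upwards [eventually_ge_atTop 1] with n hn
    have hn' : (0 : ℝ) < 4 * (n : ℝ) := by positivity
    simp only [hu, hv]
    exact div_le_div_of_nonneg_right (log_nat_mono (hS3 (4 * n))) hn'.le
  ------------------------------------------------------------------
  -- (3) w → log μ_AT
  ------------------------------------------------------------------
  have hA : Tendsto (fun n : ℕ => 4 * ((n : ℝ) - 3) * logMuAT / (4 * (n : ℝ))) atTop (𝓝 logMuAT) := by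
    have h0 : Tendsto (fun n : ℕ => (1 - 3 * (1 / (n : ℝ))) * logMuAT) atTop (𝓝 ((1 - 3 * 0) * logMuAT)) :=
      (tendsto_const_nhds.sub (tendsto_const_nhds.mul tendsto_one_div_atTop_nhds_zero_nat)).mul tendsto_const_nhds
    rw [mul_zero, sub_zero, one_mul] at h0
    refine h0.congr' ?_
    filter_upwards [eventually_ge_atTop 1] with n hn
    have hn' : (0 : ℝ) < n := by exact_mod_cast hn
    field_simp
  have hB : Tendsto (fun n : ℕ => 2 * c' * Real.sqrt n / (4 * (n : ℝ))) atTop (𝓝 0) := by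
    have h0 : Tendsto (fun n : ℕ => (2 * c' / 4) * (Real.sqrt n)⁻¹) atTop (𝓝 ((2 * c' / 4) * 0)) :=
      tendsto_const_nhds.mul tendsto_inv_sqrt_nat
    rw [mul_zero] at h0
    refine h0.congr' ?_
    filter_upwards [eventually_ge_atTop 1] with n hn
    have hn' : (0 : ℝ) < n := by exact_mod_cast hn
    have hs : 0 < Real.sqrt n := Real.sqrt_pos.2 hn'
    have hsq : Real.sqrt n * Real.sqrt n = n := Real.mul_self_sqrt hn'.le
    field_simp
    nlinarith [hsq]
  have hC : Tendsto (fun n : ℕ => Real.log (P n) / (4 * (n : ℝ))) atTop (𝓝 0) := by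
    -- 0 ≤ log P(n)/(4n) ≤ (K + 6 log n)/(4n) with K = log 16 + 6 log 4
    have hK : Tendsto (fun n : ℕ => (Real.log 16 + 6 * Real.log 4) * (1 / 4) * (1 / (n : ℝ)) +
        (6 / 4) * (Real.log n / n)) atTop (𝓝 ((Real.log 16 + 6 * Real.log 4) * (1 / 4) * 0 + (6 / 4) * 0)) :=
      (tendsto_const_nhds.mul tendsto_one_div_atTop_nhds_zero_nat).add (tendsto_const_nhds.mul tendsto_log_div_nat)
    rw [mul_zero, mul_zero, add_zero] at hK
    refine tendsto_of_tendsto_of_tendsto_of_le_of_le' tendsto_const_nhds hK ?_ ?_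
    · filter_upwards [eventually_ge_atTop 1] with n hn
      have hn' : (0 : ℝ) < 4 * (n : ℝ) := by positivity
      exact div_nonneg (Real.log_natCast_nonneg _) hn'.le
    · filter_upwards [eventually_ge_atTop 4] with n hn
      have hn' : (0 : ℝ) < n := by exact_mod_cast (show 0 < n by omega)
      -- P n ≤ 16 * (4n)^6 in ℕ
      have hPle : P n ≤ 16 * (4 * n) ^ 4 * (4 * n) ^ 2 := by
        simp only [hP]
        have h1 : 2 * (2 * n - 6) + 5 ≤ 4 * n := by omega
        have h2 : (2 * n - 6) + 3 ≤ 4 * n := by omega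
        gcongr
      have hP1 : 1 ≤ P n := by
        exact Nat.succ_le_of_lt (by simp only [hP]; positivity)
      have hlogP : Real.log (P n) ≤ Real.log 16 + 6 * Real.log 4 + 6 * Real.log n := by
        have hcast : ((P n : ℕ) : ℝ) ≤ 16 * (4 * (n : ℝ)) ^ 6 := by
          have := hPle
          calc ((P n : ℕ) : ℝ) ≤ ((16 * (4 * n) ^ 4 * (4 * n) ^ 2 : ℕ) : ℝ) := by exact_mod_cast this
            _ = 16 * (4 * (n : ℝ)) ^ 6 := by push_cast; ring
        have hPpos : (0 : ℝ) < ((P n : ℕ) : ℝ) := by exact_mod_cast hP1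
        calc Real.log (P n) ≤ Real.log (16 * (4 * (n : ℝ)) ^ 6) := Real.log_le_log hPpos hcast
          _ = Real.log 16 + 6 * (Real.log 4 + Real.log n) := by
              rw [Real.log_mul (by norm_num) (by positivity), Real.log_pow, Real.log_mul (by norm_num) hn'.ne']
              push_cast; ring
          _ = Real.log 16 + 6 * Real.log 4 + 6 * Real.log n := by ring
      have h4n : (0 : ℝ) < 4 * (n : ℝ) := by positivity
      calc Real.log (P n) / (4 * (n : ℝ)) ≤ (Real.log 16 + 6 * Real.log 4 + 6 * Real.log n) / (4 * (n : ℝ)) :=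
            div_le_div_of_nonneg_right hlogP h4n.le
        _ = (Real.log 16 + 6 * Real.log 4) * (1 / 4) * (1 / (n : ℝ)) + (6 / 4) * (Real.log n / n) := by
            field_simp
  have hw_lim : Tendsto w atTop (𝓝 logMuAT) := by
    have := (hA.sub hB).sub hC
    rw [sub_zero, sub_zero] at this
    refine this.congr' (Eventually.of_forall fun n => ?_)
    simp only [hw]
    ring
  ------------------------------------------------------------------
  -- (4) w ≤ u for n ≥ 4  (K2 at M = 2n-6, K1 at m = n-3)
  ------------------------------------------------------------------
  have hwu : ∀ᶠ n in atTop, w n ≤ u n := by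
    filter_upwards [eventually_ge_atTop 4] with n hn
    have hn' : (0 : ℝ) < n := by exact_mod_cast (show 0 < n by omega)
    have h4n : (0 : ℝ) < 4 * (n : ℝ) := by positivity
    -- K2 at M = 2n - 6
    have hM2 : 2 ≤ 2 * n - 6 := by omega
    have hMe : Even (2 * n - 6) := ⟨n - 3, by omega⟩
    have hK := hK2 (2 * n - 6) hM2 hMe
    have hidx1 : 2 * (2 * n - 6) + 12 = 4 * n := by omega
    have hidx2 : 2 * n - 6 = 2 * (n - 3) := by omega
    rw [hidx1] at hK
    -- cast K2 to ℝ
    have hKR : ((b (2 * n - 6) : ℕ) : ℝ) ^ 2 ≤ (P n : ℝ) * (allTurnPolygonCount (4 * n) : ℝ) := by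
      have := hK; simp only [hP]; exact_mod_cast this
    -- K1 at m = n - 3
    have hbm := hb (n - 3)
    rw [← hidx2] at hbm
    set b : ℝ := ((b (2 * n - 6) : ℕ) : ℝ) with hbdef
    set q : ℝ := ((allTurnPolygonCount (4 * n) : ℕ) : ℝ) with hqdef
    have hlow_pos : 0 < Real.exp (-(c' * Real.sqrt ((n - 3 : ℕ) : ℝ))) * muAT ^ (2 * n - 6) :=
      mul_pos (Real.exp_pos _) (pow_pos hμpos _)
    have hbpos : 0 < b := lt_of_lt_of_le hlow_pos hbm
    have hP1 : 1 ≤ P n := Nat.succ_le_of_lt (by simp only [hP]; positivity)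
    have hPpos : (0 : ℝ) < (P n : ℝ) := by exact_mod_cast hP1
    have hqpos : 0 < q := by
      have : 0 < (P n : ℝ) * q := lt_of_lt_of_le (by positivity) hKR
      exact pos_of_mul_pos_right this hPpos.le  -- (P>0, P*q>0 ⇒ q>0)
    -- logs
    have hlogq : 2 * Real.log b - Real.log (P n) ≤ Real.log q := by
      have h1 : Real.log (b ^ 2) ≤ Real.log ((P n : ℝ) * q) := Real.log_le_log (by positivity) hKR
      rw [Real.log_pow, Real.log_mul hPpos.ne' hqpos.ne'] at h1
      push_cast at h1
      linarith
    have hlogb : -(c' * Real.sqrt n) + ((2 * n - 6 : ℕ) : ℝ) * logMuAT ≤ Real.log b := by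
      have h1 : Real.log (Real.exp (-(c' * Real.sqrt ((n - 3 : ℕ) : ℝ))) * muAT ^ (2 * n - 6)) ≤ Real.log b :=
        Real.log_le_log hlow_pos hbm
      rw [Real.log_mul (Real.exp_pos _).ne' (pow_pos hμpos _).ne', Real.log_exp, Real.log_pow] at h1
      have hμ : Real.log muAT = logMuAT := by simp [muAT]
      rw [hμ] at h1
      have hsr : Real.sqrt ((n - 3 : ℕ) : ℝ) ≤ Real.sqrt n :=
        Real.sqrt_le_sqrt (by exact_mod_cast Nat.sub_le n 3)
      nlinarith [hsr, hc'0]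
    have hcast : ((2 * n - 6 : ℕ) : ℝ) = 2 * (n : ℝ) - 6 := by
      rw [Nat.cast_sub (by omega)]; push_cast; ring
    rw [hcast] at hlogb
    -- assemble
    simp only [hw, hu]
    refine div_le_div_of_nonneg_right ?_ h4n.le
    have : 4 * ((n : ℝ) - 3) * logMuAT - 2 * c' * Real.sqrt n - Real.log (P n) ≤
        2 * Real.log b - Real.log (P n) := by nlinarith [hlogb]
    exact this.trans hlogq
  ------------------------------------------------------------------
  exact tendsto_of_tendsto_of_tendsto_of_le_of_le' hw_lim hv_lim hwu huv

/-! ### K3R glue (a-idea-2 g9 `Final_RATE_of.lean` 046d0083, verbatim; helpers private) -/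


/-- `log y ≤ 2 √y` for `y > 0`. [folklore] -/
private theorem log_le_two_sqrt' {y : ℝ} (hy : 0 < y) : Real.log y ≤ 2 * Real.sqrt y := by
  have h1 := Real.log_le_sub_one_of_pos (Real.sqrt_pos.2 hy)
  rw [Real.log_sqrt hy.le] at h1
  linarith

/-- `log` is monotone on naturals (Lean's `log 0 = 0`). [folklore] -/
private theorem log_nat_mono' {p a : ℕ} (h : p ≤ a) : Real.log p ≤ Real.log a := by
  rcases Nat.eq_zero_or_pos p with rfl | hp
  · simp only [Nat.cast_zero, Real.log_zero]; exact Real.log_natCast_nonneg a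
  · exact Real.log_le_log (by exact_mod_cast hp) (by exact_mod_cast h)

/-- **K3R glue, final-file form**: K1 → K2 → S8 → S3 → `|log q(4n)/(4n) − log μ_AT| ≤ C/√n` (`n ≥ 4`), with
`C = 4|log μ_AT| + (log 16 + 6 log 4) + c⁺ + c₈⁺ + 4`. [cite: MadrasSlade1993, Corollary 3.2.5 / eq. (3.2.8)] -/
theorem allTurnHammersleyRate_of (bAT qAT : ℕ → ℕ)
    (hHW : ∃ c : ℝ, ∀ m : ℕ, Real.exp (-(c * Real.sqrt m)) * Real.exp logMuAT ^ (2 * m) ≤ (bAT (2 * m) : ℝ))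
    (hK2 : ∀ M : ℕ, 2 ≤ M → Even M → bAT M ^ 2 ≤ 16 * (2 * M + 5) ^ 4 * (M + 3) ^ 2 * qAT (2 * M + 12))
    (hS8 : ∃ c : ℝ, ∀ N : ℕ, (allTurnCount N : ℝ) ≤ Real.exp (c * Real.sqrt N) * Real.exp logMuAT ^ N)
    (hS3 : ∀ L : ℕ, qAT L ≤ allTurnCount (L - 1)) :
    ∃ C : ℝ, ∀ n : ℕ, 4 ≤ n → |Real.log (qAT (4 * n)) / (4 * (n : ℝ)) - logMuAT| ≤ C / Real.sqrt n := by
  set muAT : ℝ := Real.exp logMuAT with hμdef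
  obtain ⟨c, hc⟩ := hHW
  obtain ⟨c₈, hc₈⟩ := hS8
  have hμpos : 0 < muAT := Real.exp_pos _
  set L := logMuAT with hLdef
  set c' : ℝ := max c 0 with hc'def
  have hc'0 : 0 ≤ c' := le_max_right _ _
  set d : ℝ := max c₈ 0 with hddef
  have hd0 : 0 ≤ d := le_max_right _ _
  have hb : ∀ m : ℕ, Real.exp (-(c' * Real.sqrt m)) * muAT ^ (2 * m) ≤ (bAT (2 * m) : ℝ) := by
    intro m
    refine le_trans ?_ (hc m)
    have h1 : Real.exp (-(c' * Real.sqrt m)) ≤ Real.exp (-(c * Real.sqrt m)) := by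
      apply Real.exp_le_exp.2
      have := Real.sqrt_nonneg (m : ℝ)
      nlinarith [le_max_left c 0]
    exact mul_le_mul_of_nonneg_right h1 (pow_nonneg hμpos.le _)
  have ha : ∀ N : ℕ, (allTurnCount N : ℝ) ≤ Real.exp (d * Real.sqrt N) * muAT ^ N := by
    intro N
    refine (hc₈ N).trans ?_
    have h1 : Real.exp (c₈ * Real.sqrt N) ≤ Real.exp (d * Real.sqrt N) := by
      apply Real.exp_le_exp.2
      exact mul_le_mul_of_nonneg_right (le_max_left _ _) (Real.sqrt_nonneg _)
    exact mul_le_mul_of_nonneg_right h1 (pow_nonneg hμpos.le _)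
  set K₀ : ℝ := Real.log 16 + 6 * Real.log 4 with hK₀
  have hK₀0 : 0 ≤ K₀ := by
    rw [hK₀]
    have := Real.log_nonneg (show (1:ℝ) ≤ 16 by norm_num)
    have := Real.log_nonneg (show (1:ℝ) ≤ 4 by norm_num)
    positivity
  set C : ℝ := 4 * |L| + K₀ + c' + d + 4 with hCdef
  refine ⟨C, fun n hn => ?_⟩
  set P : ℕ := 16 * (2 * (2 * n - 6) + 5) ^ 4 * ((2 * n - 6) + 3) ^ 2 with hP
  have hn' : (0 : ℝ) < n := by exact_mod_cast (show 0 < n by omega)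
  have h4n : (0 : ℝ) < 4 * (n : ℝ) := by positivity
  set s : ℝ := Real.sqrt n with hsdef
  have hspos : 0 < s := Real.sqrt_pos.2 hn'
  have hss : s * s = n := Real.mul_self_sqrt hn'.le
  have hs2 : 2 ≤ s := by
    rw [hsdef, show (2 : ℝ) = Real.sqrt 4 by
      rw [show (4 : ℝ) = 2 ^ 2 by norm_num, Real.sqrt_sq (by norm_num)]]
    exact Real.sqrt_le_sqrt (by exact_mod_cast hn)
  ---------------------------------------------------------------- lower side (as in the K3 glue)
  have hM2 : 2 ≤ 2 * n - 6 := by omega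
  have hMe : Even (2 * n - 6) := ⟨n - 3, by omega⟩
  have hK := hK2 (2 * n - 6) hM2 hMe
  have hidx1 : 2 * (2 * n - 6) + 12 = 4 * n := by omega
  have hidx2 : 2 * n - 6 = 2 * (n - 3) := by omega
  rw [hidx1] at hK
  have hKR : ((bAT (2 * n - 6) : ℕ) : ℝ) ^ 2 ≤ (P : ℝ) * (qAT (4 * n) : ℝ) := by
    have := hK; simp only [hP]; exact_mod_cast this
  have hbm := hb (n - 3)
  rw [← hidx2] at hbm
  set b : ℝ := ((bAT (2 * n - 6) : ℕ) : ℝ) with hbdef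
  set q : ℝ := ((qAT (4 * n) : ℕ) : ℝ) with hqdef
  have hlow_pos : 0 < Real.exp (-(c' * Real.sqrt ((n - 3 : ℕ) : ℝ))) * muAT ^ (2 * n - 6) :=
    mul_pos (Real.exp_pos _) (pow_pos hμpos _)
  have hbpos : 0 < b := lt_of_lt_of_le hlow_pos hbm
  have hP1 : 1 ≤ P := Nat.succ_le_of_lt (by simp only [hP]; positivity)
  have hPpos : (0 : ℝ) < (P : ℝ) := by exact_mod_cast hP1
  have hqpos : 0 < q := by
    have : 0 < (P : ℝ) * q := lt_of_lt_of_le (by positivity) hKR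
    exact pos_of_mul_pos_right this hPpos.le
  have hlogq : 2 * Real.log b - Real.log (P : ℝ) ≤ Real.log q := by
    have h1 : Real.log (b ^ 2) ≤ Real.log ((P : ℝ) * q) := Real.log_le_log (by positivity) hKR
    rw [Real.log_pow, Real.log_mul hPpos.ne' hqpos.ne'] at h1
    push_cast at h1
    linarith
  have hlogb : -(c' * s) + (2 * (n : ℝ) - 6) * L ≤ Real.log b := by
    have h1 : Real.log (Real.exp (-(c' * Real.sqrt ((n - 3 : ℕ) : ℝ))) * muAT ^ (2 * n - 6)) ≤ Real.log b :=
      Real.log_le_log hlow_pos hbm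
    rw [Real.log_mul (Real.exp_pos _).ne' (pow_pos hμpos _).ne', Real.log_exp, Real.log_pow] at h1
    have hμ : Real.log muAT = L := by rw [hμdef, Real.log_exp]
    rw [hμ] at h1
    have hsr : Real.sqrt ((n - 3 : ℕ) : ℝ) ≤ s :=
      Real.sqrt_le_sqrt (by exact_mod_cast Nat.sub_le n 3)
    have hcast : ((2 * n - 6 : ℕ) : ℝ) = 2 * (n : ℝ) - 6 := by
      rw [Nat.cast_sub (by omega)]; push_cast; ring
    rw [hcast] at h1
    nlinarith [hsr, hc'0]
  have hlogP : Real.log (P : ℝ) ≤ K₀ + 12 * s := by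
    have hPle : P ≤ 16 * (4 * n) ^ 4 * (4 * n) ^ 2 := by
      simp only [hP]
      have h1 : 2 * (2 * n - 6) + 5 ≤ 4 * n := by omega
      have h2 : (2 * n - 6) + 3 ≤ 4 * n := by omega
      gcongr
    have hcast : ((P : ℕ) : ℝ) ≤ 16 * (4 * (n : ℝ)) ^ 6 := by
      calc ((P : ℕ) : ℝ) ≤ ((16 * (4 * n) ^ 4 * (4 * n) ^ 2 : ℕ) : ℝ) := by exact_mod_cast hPle
        _ = 16 * (4 * (n : ℝ)) ^ 6 := by push_cast; ring
    have hlogn : Real.log n ≤ 2 * s := log_le_two_sqrt' hn'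
    calc Real.log (P : ℝ) ≤ Real.log (16 * (4 * (n : ℝ)) ^ 6) := Real.log_le_log hPpos hcast
      _ = Real.log 16 + 6 * (Real.log 4 + Real.log n) := by
          rw [Real.log_mul (by norm_num) (by positivity), Real.log_pow, Real.log_mul (by norm_num) hn'.ne']
          push_cast; ring
      _ ≤ K₀ + 12 * s := by rw [hK₀]; linarith
  have hLs : |L| * 2 ≤ |L| * s := mul_le_mul_of_nonneg_left hs2 (abs_nonneg L)
  have hKs : K₀ * 2 ≤ K₀ * s := mul_le_mul_of_nonneg_left hs2 hK₀0
  have hcs : 0 ≤ c' * s := mul_nonneg hc'0 hspos.le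
  have hds : 0 ≤ d * s := mul_nonneg hd0 hspos.le
  have hLO : 4 * (n : ℝ) * L - Real.log q ≤ 4 * C * s := by
    have h1 : 4 * (n : ℝ) * L - Real.log q ≤ 12 * L + 2 * c' * s + K₀ + 12 * s := by
      linarith only [hlogq, hlogb, hlogP]
    have h2 : 12 * L ≤ 16 * |L| * s := by
      linarith only [le_abs_self L, abs_nonneg L, hLs]
    have h3 : K₀ ≤ 4 * K₀ * s := by linarith only [hKs, hK₀0]
    have h4 : 2 * c' * s ≤ 4 * c' * s := by linarith only [hcs]
    have h5 : (0 : ℝ) ≤ 4 * d * s := by linarith only [hds]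
    rw [hCdef]
    linarith only [h1, h2, h3, h4, h5, hspos]
  ---------------------------------------------------------------- upper side
  have hq_le : Real.log q ≤ Real.log (allTurnCount (4 * n - 1)) := by
    rw [hqdef]; exact log_nat_mono' (hS3 (4 * n))
  have haN := ha (4 * n - 1)
  have hapos : (0 : ℝ) < (allTurnCount (4 * n - 1) : ℝ) := by
    exact_mod_cast one_le_allTurnCount (4 * n - 1)
  have hloga : Real.log (allTurnCount (4 * n - 1)) ≤ d * Real.sqrt ((4 * n - 1 : ℕ) : ℝ) + (4 * (n : ℝ) - 1) * L := by
    have h1 := Real.log_le_log hapos haN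
    rw [Real.log_mul (Real.exp_pos _).ne' (pow_pos hμpos _).ne', Real.log_exp, Real.log_pow] at h1
    have hμ : Real.log muAT = L := by rw [hμdef, Real.log_exp]
    rw [hμ] at h1
    have hcast : ((4 * n - 1 : ℕ) : ℝ) = 4 * (n : ℝ) - 1 := by
      rw [Nat.cast_sub (by omega)]; push_cast; ring
    rw [hcast] at h1 ⊢
    exact h1
  have hsq4 : Real.sqrt ((4 * n - 1 : ℕ) : ℝ) ≤ 2 * s := by
    have hcast : ((4 * n - 1 : ℕ) : ℝ) = 4 * (n : ℝ) - 1 := by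
      rw [Nat.cast_sub (by omega)]; push_cast; ring
    rw [hcast, hsdef, show (2 : ℝ) = Real.sqrt 4 by
      rw [show (4 : ℝ) = 2 ^ 2 by norm_num, Real.sqrt_sq (by norm_num)], ← Real.sqrt_mul' 4 hn'.le]
    exact Real.sqrt_le_sqrt (by linarith)
  have hUP : Real.log q - 4 * (n : ℝ) * L ≤ 4 * C * s := by
    have hd4 : d * Real.sqrt ((4 * n - 1 : ℕ) : ℝ) ≤ d * (2 * s) := mul_le_mul_of_nonneg_left hsq4 hd0
    have h1 : Real.log q - 4 * (n : ℝ) * L ≤ 2 * d * s - L := by linarith only [hq_le, hloga, hd4]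
    have h2 : -L ≤ 16 * |L| * s := by
      linarith only [neg_abs_le L, abs_nonneg L, hLs]
    have h3 : (0 : ℝ) ≤ 4 * K₀ * s := by linarith only [hKs, hK₀0]
    have h4 : (0 : ℝ) ≤ 4 * c' * s := by linarith only [hcs]
    have h5 : 2 * d * s ≤ 4 * d * s := by linarith only [hds]
    rw [hCdef]
    linarith only [h1, h2, h3, h4, h5, hspos]
  ---------------------------------------------------------------- finish
  have key : |Real.log q - 4 * (n : ℝ) * L| ≤ 4 * C * s := abs_sub_le_iff.2 ⟨hUP, hLO⟩
  have e : Real.log q / (4 * (n : ℝ)) - L = (Real.log q - 4 * (n : ℝ) * L) / (4 * (n : ℝ)) := by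
    field_simp
  show |Real.log q / (4 * (n : ℝ)) - L| ≤ C / s
  rw [e, abs_div, abs_of_pos h4n, div_le_div_iff₀ h4n hspos]
  have := mul_le_mul_of_nonneg_right key hspos.le
  calc |Real.log q - 4 * (n : ℝ) * L| * s ≤ 4 * C * s * s := this
    _ = C * (4 * (n : ℝ)) := by rw [mul_assoc, hss]; ring

/-- K3R ⇒ K3: a rate `|log q(4n)/(4n) − log μ_AT| ≤ C/√n` gives the limit (squeeze `log μ_AT ∓ C/√n`); the abstract
form of Madras–Slade's passage from Theorem 3.2.3 to Corollary 3.2.5. [cite: MadrasSlade1993, Corollary 3.2.5] -/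
theorem tendsto_of_rate (qAT : ℕ → ℕ)
    (h : ∃ C : ℝ, ∀ n : ℕ, 4 ≤ n → |Real.log (qAT (4 * n)) / (4 * (n : ℝ)) - logMuAT| ≤ C / Real.sqrt n) :
    Tendsto (fun n : ℕ => Real.log (qAT (4 * n)) / (4 * (n : ℝ))) atTop (𝓝 logMuAT) := by
  obtain ⟨C, hC⟩ := h
  have hs : Tendsto (fun n : ℕ => Real.sqrt n) atTop atTop :=
    Real.tendsto_sqrt_atTop.comp tendsto_natCast_atTop_atTop
  have h0 : Tendsto (fun n : ℕ => C / Real.sqrt n) atTop (𝓝 0) := by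
    simpa [div_eq_mul_inv] using hs.inv_tendsto_atTop.const_mul C
  have hlo : Tendsto (fun n : ℕ => logMuAT - C / Real.sqrt n) atTop (𝓝 logMuAT) := by
    simpa using tendsto_const_nhds.sub h0
  have hhi : Tendsto (fun n : ℕ => logMuAT + C / Real.sqrt n) atTop (𝓝 logMuAT) := by
    simpa using tendsto_const_nhds.add h0
  refine tendsto_of_tendsto_of_tendsto_of_le_of_le' hlo hhi ?_ ?_
  · filter_upwards [eventually_ge_atTop 4] with n hn
    have h1 := (abs_le.1 (hC n hn)).1
    linarith
  · filter_upwards [eventually_ge_atTop 4] with n hn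
    have h2 := (abs_le.1 (hC n hn)).2
    linarith


/-! ### The headlines -/

/-- **«L-POLY» — the all-turn (`L`-lattice) Hammersley theorem on `ℤ²`**: `(1/4n) log q(4n) → log μ_AT` — the growth
constant of all-turn self-avoiding POLYGONS equals the all-turn WALK constant `μ_AT` (K1 + K2 through the K3
reduction). [cite: MadrasSlade1993, Corollary 3.2.5; JansevanRensburg2015, §5.3.1 (paragraph before Theorem 5.46)] -/
theorem allTurnHammersley :
    Tendsto (fun n : ℕ => Real.log (allTurnPolygonCount (4 * n)) / (4 * (n : ℝ))) atTop (𝓝 logMuAT) :=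
  allTurnHammersley_of allTurnBridgeCount allTurnHW allTurnPolygonsFromBridges

/-- **S8 `AllTurnHWUpper` — the all-turn Hammersley–Welsh UPPER bound** `a(N) ≤ e^{c√N} μ_AT^N` (from S1, S4 of
`SAWAllTurnHammersleyWelsh` through `allTurnHWUpper_of`). [cite: MadrasSlade1993, Theorem 3.1.1] -/
theorem allTurnHWUpper : ∃ c : ℝ, ∀ N : ℕ, (allTurnCount N : ℝ) ≤ Real.exp (c * Real.sqrt N) * muAT ^ N :=
  allTurnHWUpper_of allTurnSwap allTurnHWSplit

/-- **«L-POLY-RATE» — the effective all-turn Hammersley theorem**: `|log q(4n)/(4n) − log μ_AT| ≤ C/√n` for `n ≥ 4`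
(K1 + K2 + S8 + S3 through a-idea-2's K3R glue). [cite: MadrasSlade1993, Theorem 3.2.3] -/
theorem allTurnHammersleyRate : ∃ C : ℝ, ∀ n : ℕ, 4 ≤ n →
    |Real.log (allTurnPolygonCount (4 * n)) / (4 * (n : ℝ)) - logMuAT| ≤ C / Real.sqrt n :=
  allTurnHammersleyRate_of allTurnBridgeCount allTurnPolygonCount allTurnHW allTurnPolygonsFromBridges
    allTurnHWUpper polygonLeWalk

end Literature.Probability.RandomPlanarGeometry.SAW.Zd

end
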